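import Summits.BirchSwinnertonDyer.BirchSwinnertonDyer.Theorems.PrintCFramBottomClassIndexLawFiveLeBernoulliUnitsOfKrizLiClass
import HarnessLib

/-!
# Crux `PrintCFram.BottomClassIndexLawFiveLe` (stmt-BirchSwinnertonDyer-20372), line `eisenstein-resource-bdp-line` (registry v11):
# THE BERNOULLI UNITS OF THE KRIZ–LI DATUM, part III — THE FOUR LIFTS `ψ, ψε_K, ψ⁻¹ω, ψ⁻¹ωε_K` RE-INDEXED:
# an odd lift `λ` has `B_{1,λ̃⁻¹} ∈ {b₁, b₂}`, an even lift has `B_{1,(λω⁻¹)~} ∈ {b₁, b₂}` — the `hB` inputs of LEAD g8's T5 facts F1ᵈ/F2ᵈ/F3ᵈ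
# (cell `bsd-print-cfram`, width seat `bsd-line-cfram-p1-w3` g4; THEOREMS ONLY, `--supports` 20372; BSD is not proved by any of this)

HONEST FRAMING. Nothing here is a statement about BSD; no stub of the skeleton is closed. LEAD g8's blueprint (`Lines/…-lead-g8.md` §4)
types T5 as dual-form facts over the Teichmüller lift `ψ_b` of a line character: F1ᵈ (odd `b∘χ_m`): hypothesis `‖B_{1,ψ_b⁻¹}‖_p = 1`;
F2ᵈ/F3ᵈ (even `b∘χ_m`): hypothesis `‖B_{1,ψ_bω⁻¹}‖_p = 1` (tree currency `KrizLi2019.bernoulliOnePrim`). The characters met are the FOUR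
LIFTS of the two line characters: `λ ∈ {ψ, ψε_K, ψ⁻¹ω, ψ⁻¹ωε_K}` (`ψ` = the lift `ψ₁` of `θ_S`, parts I/II). This file identifies, lift by
lift and parity by parity, the number so required with Kriz–Li's `b₁ = bernoulliOnePrim (bernoulliCharOne ψ εK)` or
`b₂ = bernoulliOnePrim (bernoulliCharTwo ψ εK ω)` — EQUALITIES of `p`-adic numbers, no class input — and concludes the unit statements
from `‖b₁‖ = ‖b₂‖ = 1` (part II `norm_bernoulliPair_eq_one_of_heegner`). Table (`ε_K`, `ω` odd, `ε_K² = 1`):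
`λ = ψ`: odd ⟹ `B_{1,λ⁻¹} = b₁`, even ⟹ `B_{1,λω⁻¹} = b₂`; `λ = ψε_K`: odd ⟹ `b₁`, even ⟹ `b₂`; `λ = ψ⁻¹ω`: odd ⟹ `b₂`, even ⟹ `b₁`;
`λ = ψ⁻¹ωε_K`: odd ⟹ `b₂`, even ⟹ `b₁`. A lift `λ` (any level `n`) is specified by an equality at a common level `M`
(`changeLevel hn λ = …`), exactly as LEAD g8's T1 output and the consumers' avatars present it.

* §1 `bernoulliOnePrim_eq_of_changeLevel_eq` (same lift ⟹ same `bernoulliOnePrim`); `changeLevel_eq_of_forall_prime_apply_eq`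
  (a `ℚ_p`-valued character is determined by its prime values outside any finite set — for pinning down avatars such as `ε_K`);
* §2 the eight identifications; §3 parities + **`norm_bernoulliOnePrim_inv_eq_one_of_odd_lift`** /
  **`norm_bernoulliOnePrim_mul_omegaInv_eq_one_of_even_lift`** (the unit statements from `‖b₁‖ = ‖b₂‖ = 1`);
* §4 **`fourLifts_of_heegner`**: Stub H's binders + LEAD's disjunction for `ψ₁` + «`λ` is a lift» ⟹ the unit statement for `λ`.

beyond-print theorem: NO. References: [KrizLi2019] §1.5 (p. 7, `ψ₀`), Thm. 1.20 (p. 8), §7.1 (p. 43); the herbrand M1 memo §6 (six-term table);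
LEAD g8 report §4 (F1ᵈ/F2ᵈ/F3ᵈ).
-/

set_option autoImplicit false
set_option linter.dupNamespace false

noncomputable section

open scoped Classical
open DirichletCharacter Literature.NumberTheory.LFunctions Literature.NumberTheory.EllipticCurves.KrizLi2019
  Literature.NumberTheory.EllipticCurves Literature.NumberTheory.EllipticCurves.Rank1Residual

namespace Summit.BirchSwinnertonDyer.BirchSwinnertonDyer.Theorems.PrintCFram.BernoulliUnits

open Summit.BirchSwinnertonDyer.BirchSwinnertonDyer.Theorems.PrintCFram

variable {p : ℕ} [hp : Fact p.Prime]

/-! ## §1 Tools: `bernoulliOnePrim` only depends on the lift; parities of the four lifts -/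

section Tools

variable {n₁ n₂ M : ℕ} [NeZero n₁] [NeZero n₂] [NeZero M]

/-- Two characters with the same lift to a common level have the same `bernoulliOnePrim` (same primitive character).
[cite: KrizLi2019, §2 (p. 11, primitive characters)] -/
theorem bernoulliOnePrim_eq_of_changeLevel_eq (h₁ : n₁ ∣ M) (h₂ : n₂ ∣ M) (A : DirichletCharacter ℚ_[p] n₁)
    (B : DirichletCharacter ℚ_[p] n₂) (e : changeLevel h₁ A = changeLevel h₂ B) :
    bernoulliOnePrim A = bernoulliOnePrim B := by
  rw [← RegularLocusBernoulliPair.bernoulliOnePrim_changeLevel h₁ A, e, RegularLocusBernoulliPair.bernoulliOnePrim_changeLevel]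

omit [NeZero n₁] [NeZero n₂] in
/-- **A `ℚ_p`-valued Dirichlet character is determined by its values at the primes outside any finite set.** If `χ₁` (level `n₁`) and
`χ₂` (level `n₂`) agree at every prime `ℓ ∤ N` (`N ≠ 0`), then their lifts to any common level `M` coincide — every unit class
mod `M` contains a prime `ℓ ∤ N` (Dirichlet, as in w3 g3's `EisensteinPair.exists_prime_eq_not_dvd`). Use: the Dirichlet avatar of a
Galois character that is known only at Frobenius elements (e.g. `ε_K` via `IsKroneckerCharacterOf`) is pinned down as a character.
[cite: Washington1997, Ch. 3 (Dirichlet characters; Dirichlet's theorem on primes in progressions)] -/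
theorem changeLevel_eq_of_forall_prime_apply_eq (h₁ : n₁ ∣ M) (h₂ : n₂ ∣ M) (χ₁ : DirichletCharacter ℚ_[p] n₁)
    (χ₂ : DirichletCharacter ℚ_[p] n₂) {N : ℕ} (hN : N ≠ 0)
    (h : ∀ ℓ : ℕ, ℓ.Prime → ¬ ℓ ∣ N → (ℓ : ℕ).Coprime M → χ₁ (ℓ : ZMod n₁) = χ₂ (ℓ : ZMod n₂)) :
    changeLevel h₁ χ₁ = changeLevel h₂ χ₂ := by
  apply MulChar.ext
  intro u
  obtain ⟨ℓ, hℓ, hℓN, hℓu⟩ := EisensteinPair.exists_prime_eq_not_dvd u hN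
  have hcop : (ℓ : ℕ).Coprime M := by
    have hu : IsUnit ((ℓ : ℕ) : ZMod M) := by rw [hℓu]; exact u.isUnit
    exact (ZMod.isUnit_iff_coprime ℓ M).mp hu
  rw [← hℓu, EisensteinPair.changeLevel_apply_natCast h₁ χ₁ hcop, EisensteinPair.changeLevel_apply_natCast h₂ χ₂ hcop]
  exact h ℓ hℓ hℓN hcop

end Tools

section FourLifts

variable {f d n M : ℕ} [NeZero f] [NeZero d] [NeZero n] [NeZero M]

omit [NeZero n] in
/-- The value at `−1` of a lift is read at the common level. [folklore] -/
theorem apply_neg_one_eq_of_changeLevel_eq (hn : n ∣ M) (lam : DirichletCharacter ℚ_[p] n)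
    {A : DirichletCharacter ℚ_[p] M} (e : changeLevel hn lam = A) : lam (-1) = A (-1) := by
  rw [← EisensteinPair.changeLevel_apply_neg_one hn lam, e]

/-! ## §2 The eight identifications -/

/-- Lift `λ ~ ψ`, `ψ` odd: `B_{1,λ̃⁻¹} = b₁`. [cite: KrizLi2019, Thm. 1.20 (p. 8)] -/
theorem bernoulliOnePrim_inv_eq_of_lift_psi (hn : n ∣ M) (hf : f ∣ M) (lam : DirichletCharacter ℚ_[p] n)
    (ψ : DirichletCharacter ℚ_[p] f) (εK : DirichletCharacter ℚ_[p] d)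
    (e : changeLevel hn lam = changeLevel hf ψ) (hψ : ψ.Odd) :
    bernoulliOnePrim lam⁻¹ = bernoulliOnePrim (bernoulliCharOne ψ εK) := by
  rw [RegularLocusBernoulliPair.bernoulliOnePrim_bernoulliCharOne_of_not_even ψ εK (EisensteinPair.not_even_of_odd' ψ hψ)]
  exact bernoulliOnePrim_eq_of_changeLevel_eq hn hf _ _ (by rw [map_inv, map_inv, e])

/-- Lift `λ ~ ψ`, `ψ` even: `B_{1,(λω⁻¹)~} = b₂`. [cite: KrizLi2019, Thm. 1.20 (p. 8)] -/
theorem bernoulliOnePrim_mul_omegaInv_eq_of_lift_psi (hn : n ∣ M) (hf : f ∣ M) (hd : d ∣ M) (hfd : f * d ∣ M)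
    (lam : DirichletCharacter ℚ_[p] n) (ψ : DirichletCharacter ℚ_[p] f) (εK : DirichletCharacter ℚ_[p] d)
    (ω : DirichletCharacter ℚ_[p] p) (e : changeLevel hn lam = changeLevel hf ψ) (hψ : ψ.Even) :
    bernoulliOnePrim (changeLevel (dvd_mul_right n p) lam * changeLevel (dvd_mul_left p n) ω⁻¹) =
      bernoulliOnePrim (bernoulliCharTwo ψ εK ω) := by
  have hnp : n * p ∣ M * p := mul_dvd_mul_right hn p
  have hfdp' : f * d * p ∣ M * p := mul_dvd_mul_right hfd p
  haveI : NeZero (M * p) := ⟨Nat.mul_ne_zero (NeZero.ne M) hp.out.ne_zero⟩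
  refine bernoulliOnePrim_eq_of_changeLevel_eq hnp hfdp' _ _ ?_
  rw [EisensteinPair.changeLevel_bernoulliCharTwo (dvd_trans hf (dvd_mul_right M p)) (dvd_trans hd (dvd_mul_right M p))
    (dvd_mul_left p M) hfdp' ψ εK ω, if_pos hψ, map_mul, ← changeLevel_trans, ← changeLevel_trans, map_inv,
    changeLevel_trans lam hn (dvd_mul_right M p), e, ← changeLevel_trans]

/-- Lift `λ ~ ψε_K`, `ψ` even: `B_{1,λ̃⁻¹} = b₁` (`ε_K` quadratic). [cite: KrizLi2019, Thm. 1.20 (p. 8)] -/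
theorem bernoulliOnePrim_inv_eq_of_lift_psiEps (hn : n ∣ M) (hf : f ∣ M) (hd : d ∣ M) (hfd : f * d ∣ M)
    (lam : DirichletCharacter ℚ_[p] n) (ψ : DirichletCharacter ℚ_[p] f) (εK : DirichletCharacter ℚ_[p] d)
    (e : changeLevel hn lam = changeLevel hf ψ * changeLevel hd εK) (hψ : ψ.Even) (hεq : εK⁻¹ = εK) :
    bernoulliOnePrim lam⁻¹ = bernoulliOnePrim (bernoulliCharOne ψ εK) := by
  refine bernoulliOnePrim_eq_of_changeLevel_eq hn hfd _ _ ?_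
  rw [EisensteinPair.changeLevel_bernoulliCharOne hf hd hfd ψ εK, if_pos hψ, map_inv, e, mul_inv, ← map_inv (changeLevel hd), hεq]

/-- Lift `λ ~ ψε_K`, `ψ` odd: `B_{1,(λω⁻¹)~} = b₂`. [cite: KrizLi2019, Thm. 1.20 (p. 8)] -/
theorem bernoulliOnePrim_mul_omegaInv_eq_of_lift_psiEps (hn : n ∣ M) (hf : f ∣ M) (hd : d ∣ M) (hfd : f * d ∣ M)
    (lam : DirichletCharacter ℚ_[p] n) (ψ : DirichletCharacter ℚ_[p] f) (εK : DirichletCharacter ℚ_[p] d)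
    (ω : DirichletCharacter ℚ_[p] p) (e : changeLevel hn lam = changeLevel hf ψ * changeLevel hd εK) (hψ : ψ.Odd) :
    bernoulliOnePrim (changeLevel (dvd_mul_right n p) lam * changeLevel (dvd_mul_left p n) ω⁻¹) =
      bernoulliOnePrim (bernoulliCharTwo ψ εK ω) := by
  have hnp : n * p ∣ M * p := mul_dvd_mul_right hn p
  have hfdp' : f * d * p ∣ M * p := mul_dvd_mul_right hfd p
  haveI : NeZero (M * p) := ⟨Nat.mul_ne_zero (NeZero.ne M) hp.out.ne_zero⟩
  refine bernoulliOnePrim_eq_of_changeLevel_eq hnp hfdp' _ _ ?_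
  rw [EisensteinPair.changeLevel_bernoulliCharTwo (dvd_trans hf (dvd_mul_right M p)) (dvd_trans hd (dvd_mul_right M p))
    (dvd_mul_left p M) hfdp' ψ εK ω, if_neg (EisensteinPair.not_even_of_odd' ψ hψ), map_mul, ← changeLevel_trans,
    ← changeLevel_trans, map_inv, changeLevel_trans lam hn (dvd_mul_right M p), e, map_mul, ← changeLevel_trans,
    ← changeLevel_trans]

/-- Lift `λ ~ ψ⁻¹ω`, `ψ` even: `B_{1,λ̃⁻¹} = b₂`. [cite: KrizLi2019, Thm. 1.20 (p. 8) and §7.1 (p. 43)] -/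
theorem bernoulliOnePrim_inv_eq_of_lift_psiInvOmega (hn : n ∣ M) (hf : f ∣ M) (hd : d ∣ M) (hpM : p ∣ M)
    (hfdp : f * d * p ∣ M) (lam : DirichletCharacter ℚ_[p] n) (ψ : DirichletCharacter ℚ_[p] f)
    (εK : DirichletCharacter ℚ_[p] d) (ω : DirichletCharacter ℚ_[p] p)
    (e : changeLevel hn lam = changeLevel hf ψ⁻¹ * changeLevel hpM ω) (hψ : ψ.Even) :
    bernoulliOnePrim lam⁻¹ = bernoulliOnePrim (bernoulliCharTwo ψ εK ω) := by
  refine bernoulliOnePrim_eq_of_changeLevel_eq hn hfdp _ _ ?_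
  rw [EisensteinPair.changeLevel_bernoulliCharTwo hf hd hpM hfdp ψ εK ω, if_pos hψ, map_inv, e, mul_inv, map_inv, inv_inv]

/-- Lift `λ ~ ψ⁻¹ω`, `ψ` odd: `B_{1,(λω⁻¹)~} = b₁`. [cite: KrizLi2019, Thm. 1.20 (p. 8) and §7.1 (p. 43)] -/
theorem bernoulliOnePrim_mul_omegaInv_eq_of_lift_psiInvOmega (hn : n ∣ M) (hf : f ∣ M) (hd : d ∣ M) (hpM : p ∣ M)
    (hfd : f * d ∣ M) (lam : DirichletCharacter ℚ_[p] n) (ψ : DirichletCharacter ℚ_[p] f)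
    (εK : DirichletCharacter ℚ_[p] d) (ω : DirichletCharacter ℚ_[p] p)
    (e : changeLevel hn lam = changeLevel hf ψ⁻¹ * changeLevel hpM ω) (hψ : ψ.Odd) :
    bernoulliOnePrim (changeLevel (dvd_mul_right n p) lam * changeLevel (dvd_mul_left p n) ω⁻¹) =
      bernoulliOnePrim (bernoulliCharOne ψ εK) := by
  have hnp : n * p ∣ M * p := mul_dvd_mul_right hn p
  have hfd' : f * d ∣ M * p := dvd_trans hfd (dvd_mul_right M p)
  haveI : NeZero (M * p) := ⟨Nat.mul_ne_zero (NeZero.ne M) hp.out.ne_zero⟩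
  refine bernoulliOnePrim_eq_of_changeLevel_eq hnp hfd' _ _ ?_
  rw [EisensteinPair.changeLevel_bernoulliCharOne (dvd_trans hf (dvd_mul_right M p)) (dvd_trans hd (dvd_mul_right M p)) hfd' ψ εK,
    if_neg (EisensteinPair.not_even_of_odd' ψ hψ), map_mul, ← changeLevel_trans, ← changeLevel_trans, map_inv,
    changeLevel_trans lam hn (dvd_mul_right M p), e, map_mul, map_inv, map_inv, ← changeLevel_trans, ← changeLevel_trans,
    mul_inv_cancel_right, mul_inv, inv_mul_cancel_right]

/-- Lift `λ ~ ψ⁻¹ωε_K`, `ψ` odd: `B_{1,λ̃⁻¹} = b₂` (`ε_K` quadratic). [cite: KrizLi2019, Thm. 1.20 (p. 8) and §7.1 (p. 43)] -/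
theorem bernoulliOnePrim_inv_eq_of_lift_psiInvOmegaEps (hn : n ∣ M) (hf : f ∣ M) (hd : d ∣ M) (hpM : p ∣ M)
    (hfdp : f * d * p ∣ M) (lam : DirichletCharacter ℚ_[p] n) (ψ : DirichletCharacter ℚ_[p] f)
    (εK : DirichletCharacter ℚ_[p] d) (ω : DirichletCharacter ℚ_[p] p)
    (e : changeLevel hn lam = changeLevel hf ψ⁻¹ * changeLevel hpM ω * changeLevel hd εK) (hψ : ψ.Odd) (hεq : εK⁻¹ = εK) :
    bernoulliOnePrim lam⁻¹ = bernoulliOnePrim (bernoulliCharTwo ψ εK ω) := by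
  refine bernoulliOnePrim_eq_of_changeLevel_eq hn hfdp _ _ ?_
  rw [EisensteinPair.changeLevel_bernoulliCharTwo hf hd hpM hfdp ψ εK ω, if_neg (EisensteinPair.not_even_of_odd' ψ hψ), map_inv, e,
    mul_inv, mul_inv, map_inv, inv_inv, ← map_inv (changeLevel hd), hεq, mul_right_comm]

/-- Lift `λ ~ ψ⁻¹ωε_K`, `ψ` even: `B_{1,(λω⁻¹)~} = b₁`. [cite: KrizLi2019, Thm. 1.20 (p. 8) and §7.1 (p. 43)] -/
theorem bernoulliOnePrim_mul_omegaInv_eq_of_lift_psiInvOmegaEps (hn : n ∣ M) (hf : f ∣ M) (hd : d ∣ M) (hpM : p ∣ M)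
    (hfd : f * d ∣ M) (lam : DirichletCharacter ℚ_[p] n) (ψ : DirichletCharacter ℚ_[p] f)
    (εK : DirichletCharacter ℚ_[p] d) (ω : DirichletCharacter ℚ_[p] p)
    (e : changeLevel hn lam = changeLevel hf ψ⁻¹ * changeLevel hpM ω * changeLevel hd εK) (hψ : ψ.Even) :
    bernoulliOnePrim (changeLevel (dvd_mul_right n p) lam * changeLevel (dvd_mul_left p n) ω⁻¹) =
      bernoulliOnePrim (bernoulliCharOne ψ εK) := by
  have hnp : n * p ∣ M * p := mul_dvd_mul_right hn p
  have hfd' : f * d ∣ M * p := dvd_trans hfd (dvd_mul_right M p)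
  haveI : NeZero (M * p) := ⟨Nat.mul_ne_zero (NeZero.ne M) hp.out.ne_zero⟩
  refine bernoulliOnePrim_eq_of_changeLevel_eq hnp hfd' _ _ ?_
  rw [EisensteinPair.changeLevel_bernoulliCharOne (dvd_trans hf (dvd_mul_right M p)) (dvd_trans hd (dvd_mul_right M p)) hfd' ψ εK,
    if_pos hψ, map_mul, ← changeLevel_trans, ← changeLevel_trans, map_inv,
    changeLevel_trans lam hn (dvd_mul_right M p), e, map_mul, map_mul, map_inv, map_inv, ← changeLevel_trans, ← changeLevel_trans,
    ← changeLevel_trans, mul_right_comm, mul_inv_cancel_right]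

/-! ## §3 Parities and the unit statements for each lift -/

omit [NeZero f] [NeZero d] [NeZero n] in
/-- Parities of the four lifts (`ε_K`, `ω` odd): `λ ~ ψ` and `λ ~ ψ⁻¹ωε_K` have the parity of `ψ`; `λ ~ ψε_K` and `λ ~ ψ⁻¹ω` the
opposite one. [cite: KrizLi2019, §1.5 (p. 7)] -/
theorem odd_iff_of_lift (hn : n ∣ M) (hf : f ∣ M) (hd : d ∣ M) (hpM : p ∣ M) (lam : DirichletCharacter ℚ_[p] n)
    (ψ : DirichletCharacter ℚ_[p] f) {εK : DirichletCharacter ℚ_[p] d} {ω : DirichletCharacter ℚ_[p] p}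
    (hεodd : εK.Odd) (hω : ω.Odd) :
    (changeLevel hn lam = changeLevel hf ψ → (lam.Odd ↔ ψ.Odd)) ∧
    (changeLevel hn lam = changeLevel hf ψ * changeLevel hd εK → (lam.Odd ↔ ψ.Even)) ∧
    (changeLevel hn lam = changeLevel hf ψ⁻¹ * changeLevel hpM ω → (lam.Odd ↔ ψ.Even)) ∧
    (changeLevel hn lam = changeLevel hf ψ⁻¹ * changeLevel hpM ω * changeLevel hd εK → (lam.Odd ↔ ψ.Odd)) := by
  have hε1 : changeLevel hd εK (-1) = -1 := by rw [EisensteinPair.changeLevel_apply_neg_one]; exact hεodd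
  have hω1 : changeLevel hpM ω (-1) = -1 := by rw [EisensteinPair.changeLevel_apply_neg_one]; exact hω
  have hψ1 : changeLevel hf ψ (-1) = ψ (-1) := EisensteinPair.changeLevel_apply_neg_one hf ψ
  have hψinv : changeLevel hf ψ⁻¹ (-1) = ψ (-1) := by
    rw [map_inv, MulChar.inv_apply_eq_inv', hψ1]
    rcases ψ.even_or_odd with h | h
    · rw [h, inv_one]
    · rw [h, inv_neg, inv_one]
  have h2 : (-1 : ℚ_[p]) ≠ 1 := fun h => by
    have : (2 : ℚ_[p]) = 0 := by linear_combination -h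
    exact two_ne_zero this
  unfold DirichletCharacter.Odd DirichletCharacter.Even
  refine ⟨fun e => ?_, fun e => ?_, fun e => ?_, fun e => ?_⟩
  · rw [apply_neg_one_eq_of_changeLevel_eq hn lam e, hψ1]
  · rw [apply_neg_one_eq_of_changeLevel_eq hn lam e, MulChar.mul_apply, hψ1, hε1]
    rcases ψ.even_or_odd with h | h
    · rw [h]; simp
    · rw [h]; simp only [mul_neg, mul_one, neg_neg]; exact ⟨fun h' => absurd h'.symm h2, fun h' => absurd h' h2⟩
  · rw [apply_neg_one_eq_of_changeLevel_eq hn lam e, MulChar.mul_apply, hψinv, hω1]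
    rcases ψ.even_or_odd with h | h
    · rw [h]; simp
    · rw [h]; simp only [mul_neg, mul_one, neg_neg]; exact ⟨fun h' => absurd h'.symm h2, fun h' => absurd h' h2⟩
  · rw [apply_neg_one_eq_of_changeLevel_eq hn lam e, MulChar.mul_apply, MulChar.mul_apply, hψinv, hω1, hε1]
    simp

/-- **THE FOUR LIFTS, odd case: `‖B_{1,λ̃⁻¹}‖_p = 1`** — the `hB` hypothesis of F1ᵈ / Mazur–Wiles for every ODD lift `λ` of a line
character (`λ↑ ∈ {ψ↑, ψ↑ε_K↑, ψ⁻¹↑ω↑, ψ⁻¹↑ω↑ε_K↑}`), from the two units `‖b₁‖ = ‖b₂‖ = 1` of part II (`ε_K` odd and quadratic, `ω` odd).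
[cite: KrizLi2019, Thm. 1.20 (p. 8), §7.1 (p. 43)] [cite: MazurWiles1984, Thm. 2 (p. 216)] -/
theorem norm_bernoulliOnePrim_inv_eq_one_of_odd_lift (hn : n ∣ M) (hf : f ∣ M) (hd : d ∣ M) (hpM : p ∣ M) (hfd : f * d ∣ M)
    (hfdp : f * d * p ∣ M) (lam : DirichletCharacter ℚ_[p] n) (ψ : DirichletCharacter ℚ_[p] f)
    {εK : DirichletCharacter ℚ_[p] d} {ω : DirichletCharacter ℚ_[p] p} (hεodd : εK.Odd) (hεq : εK⁻¹ = εK) (hω : ω.Odd)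
    (hb : ‖bernoulliOnePrim (bernoulliCharOne ψ εK)‖ = 1 ∧ ‖bernoulliOnePrim (bernoulliCharTwo ψ εK ω)‖ = 1)
    (e : changeLevel hn lam = changeLevel hf ψ ∨ changeLevel hn lam = changeLevel hf ψ * changeLevel hd εK ∨
      changeLevel hn lam = changeLevel hf ψ⁻¹ * changeLevel hpM ω ∨
      changeLevel hn lam = changeLevel hf ψ⁻¹ * changeLevel hpM ω * changeLevel hd εK)
    (hodd : lam.Odd) : ‖bernoulliOnePrim lam⁻¹‖ = 1 := by
  obtain ⟨c1, c2, c3, c4⟩ := odd_iff_of_lift hn hf hd hpM lam ψ hεodd hω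
  rcases e with e | e | e | e
  · rw [bernoulliOnePrim_inv_eq_of_lift_psi hn hf lam ψ εK e ((c1 e).mp hodd)]; exact hb.1
  · rw [bernoulliOnePrim_inv_eq_of_lift_psiEps hn hf hd hfd lam ψ εK e ((c2 e).mp hodd) hεq]; exact hb.1
  · rw [bernoulliOnePrim_inv_eq_of_lift_psiInvOmega hn hf hd hpM hfdp lam ψ εK ω e ((c3 e).mp hodd)]; exact hb.2
  · rw [bernoulliOnePrim_inv_eq_of_lift_psiInvOmegaEps hn hf hd hpM hfdp lam ψ εK ω e ((c4 e).mp hodd) hεq]; exact hb.2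

/-- **THE FOUR LIFTS, even case: `‖B_{1,(λω⁻¹)~}‖_p = 1`** — the `hB` hypothesis of F2ᵈ/F3ᵈ (reflection partner, unit index) for every
EVEN lift `λ` of a line character, from the two units `‖b₁‖ = ‖b₂‖ = 1` of part II. [cite: KrizLi2019, Thm. 1.20 (p. 8), §7.1 (p. 43)]
[cite: Washington1997, Thm. 10.9 (reflection)] -/
theorem norm_bernoulliOnePrim_mul_omegaInv_eq_one_of_even_lift (hn : n ∣ M) (hf : f ∣ M) (hd : d ∣ M) (hpM : p ∣ M)
    (hfd : f * d ∣ M) (lam : DirichletCharacter ℚ_[p] n) (ψ : DirichletCharacter ℚ_[p] f)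
    {εK : DirichletCharacter ℚ_[p] d} {ω : DirichletCharacter ℚ_[p] p} (hεodd : εK.Odd) (hω : ω.Odd)
    (hb : ‖bernoulliOnePrim (bernoulliCharOne ψ εK)‖ = 1 ∧ ‖bernoulliOnePrim (bernoulliCharTwo ψ εK ω)‖ = 1)
    (e : changeLevel hn lam = changeLevel hf ψ ∨ changeLevel hn lam = changeLevel hf ψ * changeLevel hd εK ∨
      changeLevel hn lam = changeLevel hf ψ⁻¹ * changeLevel hpM ω ∨
      changeLevel hn lam = changeLevel hf ψ⁻¹ * changeLevel hpM ω * changeLevel hd εK)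
    (heven : lam.Even) :
    ‖bernoulliOnePrim (changeLevel (dvd_mul_right n p) lam * changeLevel (dvd_mul_left p n) ω⁻¹)‖ = 1 := by
  obtain ⟨c1, c2, c3, c4⟩ := odd_iff_of_lift hn hf hd hpM lam ψ hεodd hω
  have hne : ¬ lam.Odd := fun h => EisensteinPair.not_even_of_odd' lam h heven
  rcases e with e | e | e | e
  · have hψ : ψ.Even := ψ.even_or_odd.resolve_right (fun h => hne ((c1 e).mpr h))
    rw [bernoulliOnePrim_mul_omegaInv_eq_of_lift_psi hn hf hd hfd lam ψ εK ω e hψ]; exact hb.2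
  · have hψ : ψ.Odd := ψ.even_or_odd.resolve_left (fun h => hne ((c2 e).mpr h))
    rw [bernoulliOnePrim_mul_omegaInv_eq_of_lift_psiEps hn hf hd hfd lam ψ εK ω e hψ]; exact hb.2
  · have hψ : ψ.Odd := ψ.even_or_odd.resolve_left (fun h => hne ((c3 e).mpr h))
    rw [bernoulliOnePrim_mul_omegaInv_eq_of_lift_psiInvOmega hn hf hd hpM hfd lam ψ εK ω e hψ]; exact hb.1
  · have hψ : ψ.Even := ψ.even_or_odd.resolve_right (fun h => hne ((c4 e).mpr h))
    rw [bernoulliOnePrim_mul_omegaInv_eq_of_lift_psiInvOmegaEps hn hf hd hpM hfd lam ψ εK ω e hψ]; exact hb.1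

end FourLifts

/-! ## §4 END STATE with Stub H's binders: every lift of a line character has its Bernoulli unit -/

section EndState

variable (W : WeierstrassCurve ℚ) [W.IsElliptic] [W.IsGloballyMinimal]

/-- **THE FOUR LIFTS ON THE CLASS (END STATE, Stub H's binders verbatim).** `W/ℚ` globally minimal with CM, `p ≥ 5` CM-ramified, Heegner
field `K` of `N = N_W`, Kriz–Li's `(f, ψ, ω, ε_K)` with `hss`, `IsKroneckerCharacterOf K ε_K` and hypothesis (4); `ψ₁` (level `m`) with
LEAD g8's disjunction `ψ↑ = ψ₁↑ ∨ ψ↑ = ψ₁⁻¹↑·ω↑`; and ANY character `λ` (level `n`) which is one of the four lifts of the two line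
characters, `λ↑ ∈ {ψ₁↑, ψ₁↑ε_K↑, ψ₁⁻¹↑ω↑, ψ₁⁻¹↑ω↑ε_K↑}` at some common level `M'`. THEN: if `λ` is odd, `‖bernoulliOnePrim λ⁻¹‖_p = 1`
(the `hB` of F1ᵈ / Mazur–Wiles); if `λ` is even, `‖bernoulliOnePrim (λ↑·ω⁻¹↑)‖_p = 1` (the `hB` of F2ᵈ/F3ᵈ). No further input.
[cite: KrizLi2019, Thm. 1.20 (pp. 7–8), §7.1 (p. 43)] [cite: MazurWiles1984, Thm. 2 (p. 216)] [cite: Washington1997, Thm. 10.9 and Thm. 5.11] -/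
theorem fourLifts_of_heegner (hCM : W.HasCM) (hram : CMRamified W p) (h5 : 5 ≤ p)
    (N : ℕ) (K : Type) [Field K] [NumberField K]
    {f : ℕ} [NeZero f] (ψ : DirichletCharacter ℚ_[p] f) (ω : DirichletCharacter ℚ_[p] p)
    (εK : DirichletCharacter ℚ_[p] (NumberField.discr K).natAbs)
    (hN : W.conductorNorm ℤ = N) (hK : IsImaginaryQuadratic K) (hH : SatisfiesHeegnerHypothesis N K)
    (hω : IsTeichmullerCharacter ω)
    (hss : ∀ ℓ : ℕ, ℓ.Prime → ¬ (ℓ ∣ p * W.conductorNorm ℤ) →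
      ‖((W.LFunction ℓ : ℤ) : ℚ_[p]) - (ψ (ℓ : ZMod f) + ψ⁻¹ (ℓ : ZMod f) * ω (ℓ : ZMod p))‖ < 1)
    (hεK : IsKroneckerCharacterOf K εK)
    (h4 : ¬ ‖bernoulliOnePrim (bernoulliCharOne ψ εK) * bernoulliOnePrim (bernoulliCharTwo ψ εK ω)‖ ≤ (p : ℝ)⁻¹)
    {m : ℕ} [NeZero m] (ψ₁ : DirichletCharacter ℚ_[p] m) {M : ℕ} [NeZero M] (hf : f ∣ M) (hm : m ∣ M) (hpM : p ∣ M)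
    (e : changeLevel hf ψ = changeLevel hm ψ₁ ∨ changeLevel hf ψ = changeLevel hm ψ₁⁻¹ * changeLevel hpM ω)
    {n : ℕ} [NeZero n] (lam : DirichletCharacter ℚ_[p] n) {M' : ℕ} [NeZero M'] (hn : n ∣ M') (hm' : m ∣ M')
    (hd : (NumberField.discr K).natAbs ∣ M') (hpM' : p ∣ M') (hmd : m * (NumberField.discr K).natAbs ∣ M')
    (hmdp : m * (NumberField.discr K).natAbs * p ∣ M')
    (el : changeLevel hn lam = changeLevel hm' ψ₁ ∨ changeLevel hn lam = changeLevel hm' ψ₁ * changeLevel hd εK ∨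
      changeLevel hn lam = changeLevel hm' ψ₁⁻¹ * changeLevel hpM' ω ∨
      changeLevel hn lam = changeLevel hm' ψ₁⁻¹ * changeLevel hpM' ω * changeLevel hd εK) :
    (lam.Odd → ‖bernoulliOnePrim lam⁻¹‖ = 1) ∧
    (lam.Even → ‖bernoulliOnePrim (changeLevel (dvd_mul_right n p) lam * changeLevel (dvd_mul_left p n) ω⁻¹)‖ = 1) := by
  haveI : NeZero (NumberField.discr K).natAbs := ⟨Int.natAbs_ne_zero.mpr (NumberField.discr_ne_zero K)⟩
  have hp2 : p ≠ 2 := by have := hp.out.two_le; omega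
  have hωodd : ω.Odd := KrizLiBinders.teichmuller_apply_neg_one hp2 hω
  have hεq : εK⁻¹ = εK := inv_eq_self_of_isKroneckerCharacterOf K hεK
  have hεodd : εK.Odd := odd_of_isKroneckerCharacterOf K hK hεK
  obtain ⟨-, hall⟩ := norm_bernoulliPair_eq_one_of_heegner W hCM hram h5 N K ψ ω εK hN hK hH hω hss h4
  have hb := hall ψ₁ hf hm hpM e
  exact ⟨norm_bernoulliOnePrim_inv_eq_one_of_odd_lift hn hm' hd hpM' hmd hmdp lam ψ₁ hεodd hεq hωodd hb el,
    norm_bernoulliOnePrim_mul_omegaInv_eq_one_of_even_lift hn hm' hd hpM' hmd lam ψ₁ hεodd hωodd hb el⟩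

end EndState

end Summit.BirchSwinnertonDyer.BirchSwinnertonDyer.Theorems.PrintCFram.BernoulliUnits

end
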